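/-
Origin: expansion seat `planner-pub-hodgecm-pv11-g2-0`, handover 2026-08-18 (`HOME/pub-hodgecm-pv11-g2/lean/Pv11g2/RationalCoset.lean`, md5 36f4dc68, 156 lines);
landed by the gen-6 packager in gate run 22 as `HodgeCM/PerL34/RationalCoset.lean` (stripped 3 #print/#check/#eval lines).
-/
import Mathlib.Topology.Algebra.InfiniteSum.Basic
import Mathlib.Algebra.Module.Submodule.Map
import Mathlib.Algebra.Module.Rat
import Mathlib.Logic.Equiv.Set

/-!
# Rational points of a thinned lattice coset: the kernel content of the dictionary sentence (D4) `hval`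

Unit `pub-hodgecm-pv11-g2` (DAG node #11, gen 2).  Proposed final place:
`HodgeCM/PerL34/RationalCoset.lean` (imports `Mathlib.*` only).

Route (E) (`HodgeCM.PerL34.SupplyElementary.supply₁/₂_of_lattice`, field `SupplyBridge.hval`) consumes
the DICTIONARY sentence

  (D4) `θ_{φ_N}(g₀, u₀) = Σ_{v ∈ Λ} φ_∞(x₀ + N • v)`   for `φ_N = φ_∞ ⊗ 1_{x₀ + N 𝔏}`.

In the Schrödinger model the theta kernel at the base point is, BY DEFINITION, the sum of `φ_N` over the
RATIONAL points `V(K)`; for a pure tensor `φ_∞ ⊗ 1_{x₀ + N 𝔏}` (`𝔏 = L̂ ⊂ V(𝔸_f)` the closure of the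
lattice) the summand is `φ_∞(ξ) · 1[ξ_f ∈ x₀ + N L̂]`.  What turns this into (D4) is the computation

  (A) `V(K) ∩ (x₀ + N • L̂) = x₀ + N • L`,  `L := V(K) ∩ L̂`  (`N ≥ 1`),
  (B) `Σ_{ξ ∈ V(K)} 1[ξ ∈ x₀ + N L̂] Φ(ξ) = Σ_{v ∈ L} Φ(x₀ + N • v)`  (re-indexing by the bijection
      `v ↦ x₀ + N • v`, no convergence needed).

This file proves (A) and (B) over BARE CARRIERS: `VK` (for `V(K)`) and `Vf` (for `V(𝔸_f)`) are
`ℚ`-modules, `ιf : VK →ₗ[ℚ] Vf` the (finite-adelic) diagonal map, `Lhat : Submodule ℤ Vf` (for `L̂`), and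
`globalLattice ιf Lhat := ιf⁻¹ Lhat` (for `L`).  The only input used is divisibility by `N` in a
`ℚ`-module.  After this file the residue of (D4) is the genuinely model-level sentence
"`θ_φ(g₀,u₀) = Σ_{ξ ∈ V(K)} φ(ξ)` and `φ_N(ξ) = φ_∞(ξ_∞) · 1_{x₀ + N L̂}(ξ_f)`" (`SupplyCoset.hker`).

No statement of the 2001 programme, of PerL or of QW8 is used or cited.
-/

set_option autoImplicit false

noncomputable section

open Set

namespace HodgeCM
namespace PerL34
namespace RationalCoset

variable {VK Vf : Type*} [AddCommGroup VK] [Module ℚ VK] [AddCommGroup Vf] [Module ℚ Vf]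
  (ιf : VK →ₗ[ℚ] Vf) (Lhat : Submodule ℤ Vf)

/-- The global lattice cut out by the local one: `L := V(K) ∩ L̂ = ιf⁻¹ L̂`. -/
def globalLattice : Submodule ℤ VK := Lhat.comap (ιf.restrictScalars ℤ)

/-- (Ported verbatim from the HodgeCMPerL package; no docstring in the source.) -/
@[simp] theorem mem_globalLattice (ξ : VK) : ξ ∈ globalLattice ιf Lhat ↔ ιf ξ ∈ Lhat := Iff.rfl

/-- The thinned coset `x + N • L̂ ⊂ V(𝔸_f)` (the support of the finite part `1_{x₀ + N𝔏}` of `φ_N`). -/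
def thinCoset (x : Vf) (N : ℕ) : Set Vf := {y | ∃ l ∈ Lhat, y = x + N • l}

/-- Its trace on the rational points: `{ξ ∈ V(K) | ιf ξ ∈ ιf x₀ + N • L̂}` = the support of `φ_N` on
`V(K)`. -/
def thinCosetK (x₀ : VK) (N : ℕ) : Set VK := {ξ | ιf ξ ∈ thinCoset Lhat (ιf x₀) N}

/-- (Ported verbatim from the HodgeCMPerL package; no docstring in the source.) -/
theorem mem_thinCosetK (x₀ ξ : VK) (N : ℕ) :
    ξ ∈ thinCosetK ιf Lhat x₀ N ↔ ∃ l ∈ Lhat, ιf ξ = ιf x₀ + N • l := Iff.rfl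

/-- Division by `N` in a `ℚ`-module. -/
theorem nsmul_inv_smul {M : Type*} [AddCommGroup M] [Module ℚ M] {N : ℕ} (hN : N ≠ 0) (m : M) :
    N • ((N : ℚ)⁻¹ • m) = m := by
  rw [← Nat.cast_smul_eq_nsmul ℚ, smul_smul, mul_inv_cancel₀ (by exact_mod_cast hN), one_smul]

/-- (Ported verbatim from the HodgeCMPerL package; no docstring in the source.) -/
theorem inv_smul_nsmul {M : Type*} [AddCommGroup M] [Module ℚ M] {N : ℕ} (hN : N ≠ 0) (m : M) :
    (N : ℚ)⁻¹ • (N • m) = m := by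
  rw [← Nat.cast_smul_eq_nsmul ℚ, smul_smul, inv_mul_cancel₀ (by exact_mod_cast hN), one_smul]

/-- (Ported verbatim from the HodgeCMPerL package; no docstring in the source.) -/
theorem nsmul_right_injective {M : Type*} [AddCommGroup M] [Module ℚ M] {N : ℕ} (hN : N ≠ 0) :
    Function.Injective fun m : M => N • m := by
  intro a b h
  have := congrArg (fun m : M => (N : ℚ)⁻¹ • m) h
  simpa only [inv_smul_nsmul hN] using this

/-- **(A)** `V(K) ∩ (x₀ + N • L̂) = x₀ + N • L` for `N ≥ 1`: the rational points of the thinned coset are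
exactly the translates `x₀ + N • v`, `v ∈ L`. -/
theorem mem_thinCosetK_iff {N : ℕ} (hN : N ≠ 0) (x₀ ξ : VK) :
    ξ ∈ thinCosetK ιf Lhat x₀ N ↔ ∃ v ∈ globalLattice ιf Lhat, ξ = x₀ + N • v := by
  constructor
  · rintro ⟨l, hl, h⟩
    refine ⟨(N : ℚ)⁻¹ • (ξ - x₀), ?_, ?_⟩
    · rw [mem_globalLattice, map_smul, map_sub, h, add_sub_cancel_left, inv_smul_nsmul hN]
      exact hl
    · rw [nsmul_inv_smul hN, add_sub_cancel]
  · rintro ⟨v, hv, rfl⟩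
    exact ⟨ιf v, hv, by rw [map_add, map_nsmul]⟩

/-- `v ↦ x₀ + N • v` is injective on `L` (`V(K)` is torsion-free). -/
theorem translate_nsmul_injective {N : ℕ} (hN : N ≠ 0) (x₀ : VK) :
    Function.Injective fun v : globalLattice ιf Lhat => x₀ + N • (v : VK) := by
  intro v w h
  have h' : N • (v : VK) = N • (w : VK) := add_left_cancel h
  exact Subtype.ext (nsmul_right_injective hN h')

/-- (A) as an equality of sets: the rational points of the thinned coset = the range of `v ↦ x₀ + N • v`. -/
theorem thinCosetK_eq_range {N : ℕ} (hN : N ≠ 0) (x₀ : VK) :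
    thinCosetK ιf Lhat x₀ N = Set.range fun v : globalLattice ιf Lhat => x₀ + N • (v : VK) := by
  ext ξ
  rw [mem_thinCosetK_iff ιf Lhat hN, Set.mem_range]
  constructor
  · rintro ⟨v, hv, rfl⟩
    exact ⟨⟨v, hv⟩, rfl⟩
  · rintro ⟨v, rfl⟩
    exact ⟨v, v.2, rfl⟩

/-- The bijection `L ≃ V(K) ∩ (x₀ + N • L̂)`, `v ↦ x₀ + N • v`. -/
def cosetEquiv {N : ℕ} (hN : N ≠ 0) (x₀ : VK) : globalLattice ιf Lhat ≃ thinCosetK ιf Lhat x₀ N :=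
  (Equiv.ofInjective _ (translate_nsmul_injective ιf Lhat hN x₀)).trans
    (Equiv.setCongr (thinCosetK_eq_range ιf Lhat hN x₀).symm)

/-- (Ported verbatim from the HodgeCMPerL package; no docstring in the source.) -/
@[simp] theorem coe_cosetEquiv {N : ℕ} (hN : N ≠ 0) (x₀ : VK) (v : globalLattice ιf Lhat) :
    ((cosetEquiv ιf Lhat hN x₀ v : thinCosetK ιf Lhat x₀ N) : VK) = x₀ + N • (v : VK) := rfl

/-- **(B)** the value at the base point of the theta series of `φ_∞ ⊗ 1_{x₀ + N𝔏}` — i.e. the sum over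
the rational points `V(K)` of `1[ξ ∈ x₀ + N L̂] · Φ(ξ)` — IS the thinned lattice sum
`Σ_{v ∈ L} Φ(x₀ + N • v)` (pure re-indexing; no convergence hypothesis; `Φ` arbitrary, e.g.
`Φ = φ_∞ ∘ ι_∞`). -/
theorem tsum_indicator_thinCosetK {F : Type*} [AddCommMonoid F] [TopologicalSpace F] {N : ℕ}
    (hN : N ≠ 0) (x₀ : VK) (Φ : VK → F) :
    ∑' ξ : VK, (thinCosetK ιf Lhat x₀ N).indicator Φ ξ =
      ∑' v : globalLattice ιf Lhat, Φ (x₀ + N • (v : VK)) := by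
  calc ∑' ξ : VK, (thinCosetK ιf Lhat x₀ N).indicator Φ ξ
      = ∑' ξ : thinCosetK ιf Lhat x₀ N, Φ (ξ : VK) := (tsum_subtype _ Φ).symm
    _ = ∑' v : globalLattice ιf Lhat, Φ ((cosetEquiv ιf Lhat hN x₀ v : thinCosetK ιf Lhat x₀ N) : VK) :=
        ((cosetEquiv ιf Lhat hN x₀).tsum_eq (fun ξ : thinCosetK ιf Lhat x₀ N => Φ (ξ : VK))).symm
    _ = ∑' v : globalLattice ιf Lhat, Φ (x₀ + N • (v : VK)) := rfl

/-- Summability transfers along the same bijection. -/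
theorem summable_indicator_thinCosetK_iff {F : Type*} [AddCommMonoid F] [TopologicalSpace F] {N : ℕ}
    (hN : N ≠ 0) (x₀ : VK) (Φ : VK → F) :
    Summable ((thinCosetK ιf Lhat x₀ N).indicator Φ) ↔
      Summable fun v : globalLattice ιf Lhat => Φ (x₀ + N • (v : VK)) := by
  rw [← summable_subtype_iff_indicator,
    ← (cosetEquiv ιf Lhat hN x₀).summable_iff (f := Φ ∘ ((↑) : thinCosetK ιf Lhat x₀ N → VK))]
  exact Iff.rfl

/-- The thinned lattice sum in the shape consumed by `SupplyElementary.supply₁/₂_of_lattice`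
(`∑' v, F (N • v)` with `F v := Φ (x₀ + v)` on `Λ := L`). -/
theorem tsum_indicator_thinCosetK' {F : Type*} [AddCommMonoid F] [TopologicalSpace F] {N : ℕ}
    (hN : N ≠ 0) (x₀ : VK) (Φ : VK → F) :
    ∑' ξ : VK, (thinCosetK ιf Lhat x₀ N).indicator Φ ξ =
      ∑' v : globalLattice ιf Lhat, Φ (x₀ + ((N • v : globalLattice ιf Lhat) : VK)) := by
  rw [tsum_indicator_thinCosetK ιf Lhat hN x₀ Φ]
  rfl

end RationalCoset
end PerL34
end HodgeCM

end

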